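import Summits.AtomisticToContinuum.HydrodynamicLimit.Theses.DimensionLadder

/-!
# Line `EngineHalves` — checked skeleton AND route-level decomposition certificate for the crux `AllDimensionEuler`
(stmt-AtomisticToContinuum-9342; route `route-AtomisticToContinuum-DimensionLadder`, decl
`Summit.AtomisticToContinuum.HydrodynamicLimit.Theses.DimensionLadder.AllDimensionEuler`; crux-strategist
`planner-cstrat-stmt-AtomisticToContinuum-9342-r1-0`, 2026-08-17, RESTATED re-audit / BC2 redirect exemption)

## Why this file exists

`AllDimensionEuler` (X) is the route's deciding crux: `closes : AllDimensionEuler → HydrodynamicLimit` takes its `d = 3`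
member, so X is AT LEAST the Statement (one-crux audit 2026-08-17: RESTATED/AT-LEAST-SUMMIT). It counts as an honest
reduction only through a TYPED DECOMPOSITION one level down whose pieces are each NOT the summit and NOT X, glued by a
PROVED, non-trivial assembly. This file is that decomposition, kernel-checked:

  `forall_hydroLimitInBandDim_of_halves : OneBodyMaxwellianAllDim → PairFactorisationAllDim → FlowRelabelSymmetry → MarginalsToFieldsAllDim → ∀ d ≥ 3, HydroLimitInBandDim d`
  `AllDimensionEuler_of : AllDimensionEuler` (:= the above at the four registered stubs, via `hydroLimitInBandDim_iff`)

* `OneBodyMaxwellianAllDim` (NEW crux, stub 1) — IDENTIFICATION: for every `d ≥ 3`, under the guarded hypotheses of X, the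
  one-particle marginal of the time-`t` hard-sphere density `1_D · (canonical local-Gibbs density ∘ Φ_N(−t))` converges in
  `(1+|v|²)²`-weighted `L¹` to the local Maxwellian `ρ_t(x) M_{1,u_t(x),θ_t(x)}(v)` of the classical Euler solution.
* `PairFactorisationAllDim` (NEW crux, stub 2) — CONCENTRATION: the two-particle marginal minus the product of the
  one-particle marginals tends to `0` in `(1+|v|²)(1+|v′|²)`-weighted `L¹` (asymptotic pair independence; says nothing
  about WHICH one-body law).
* `FlowRelabelSymmetry` (route support item stmt-9346, stub 3) — exchangeability of the time-`t` density.
* `MarginalsToFieldsAllDim` (route support item stmt-9345, stub 4) — the Sznitman/Chebyshev step: exchangeable law +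
  1-marginal → `ρ_t M` + pair factorisation ⇒ LLN of the empirical density / momentum / energy fields.

The two new cruxes are the two HALVES of the route's joint engine `LocalEquilibriumAllDim` (stmt-9344, whose conclusion
is their conjunction under shared thresholds): `oneBodyMaxwellianAllDim_of_engine`, `pairFactorisationAllDim_of_engine`.
Hence also `engineToAllDim_holds : EngineToAllDim` (route glue item stmt-14524, PROVED here) and
`assembly_holds : Assembly` (stmt-17301, PROVED here).

## The seam, and why it is not trivial

X is a LAW OF LARGE NUMBERS for five empirical fields. LLN = identification of the mean + vanishing of the variance. For an
exchangeable `N`-particle law the mean of an empirical field is an integral against the 1-marginal and its variance is an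
integral against (2-marginal − 1-marginal ⊗ 1-marginal) plus `O(1/N)` (Sznitman 1991 Prop. 2.2; GST2013 §2.4). The
assembly `forall_hydroLimitInBandDim_of_halves` is therefore genuine mathematics and genuine Lean (≈ 30 tactic lines,
not `exact ⟨h₁, h₂⟩`): thresholds `η₀ := min η₁ η₂`, `σ₀ := min σ₁ σ₂` and the two guards; continuity of the time
slices `ρ_t, u_t, θ_t` from joint smoothness (`IsSmoothSpaceTimeOn.isSmooth_slice`, `IsSmooth.continuous`);
`θ_t > 0` from the solution class; exchangeability of the time-`t` density from `FlowRelabelSymmetry`; then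
`MarginalsToFieldsAllDim`; finally transport from the Literature form `∀ d ≥ 3, HydroLimitInBandDim d` to the inlined X by
`hydroLimitInBandDim_iff` (`allDimensionEuler_iff_forall_hydroLimitInBandDim`).

## Why no piece is the summit or X (probes in `bc/`, all FAIL; mathematics here)

* `OneBodyMaxwellianAllDim ↛ HydrodynamicLimit`: convergence of the ONE-BODY law gives convergence of the MEAN of each
  empirical field, not convergence in probability (a law that mixes two macroscopic evolutions has the right one-body
  limit of neither but illustrates the gap: mean ≠ LLN without a variance bound). `HydrodynamicLimit ↛ OneBody…`: the LLN
  of `(ρ, ρu, E)` tests three velocity moments only and says nothing about the velocity distribution being Maxwellian.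
  INCOMPARABLE with S; strictly weaker than X's engine; ↛ X (needs stubs 2–4).
* `PairFactorisationAllDim ↛ HydrodynamicLimit`: pair independence identifies no limit. `HydrodynamicLimit ↛ Pair…`: the
  field LLN gives decorrelation of POSITION pairs tested against `χ ⊗ χ` only, not phase-space weighted-`L¹`
  factorisation. INCOMPARABLE with S; ↛ X.
* `FlowRelabelSymmetry`, `MarginalsToFieldsAllDim`: provable-now support statements (relabelling invariance of hard-sphere
  flows; Sznitman's variance computation), obviously neither ≥ S nor ≥ X.
Probe record (farm, 2026-08-17, `bc/<Piece>_probe.lean`, `set_option maxHeartbeats 400000`): for each of the four pieces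
`exact?` ALONE on `Piece → HydrodynamicLimit` and on `Piece → AllDimensionEuler` answers "could not close the goal", and
the full chain `first | exact? | simpa [Piece] | (unfold Piece; simpa) | aesop` fails (heartbeat exhaustion on the 3 kB
goals or "aesop: failed to prove the goal after exhaustive search"); the converses `HydrodynamicLimit → Piece`,
`AllDimensionEuler → Piece` fail likewise (16/16 + 8/8). No landed `iff`/implication between any piece and S or X exists
(`lean search`), no `summit_equivalent` mark.

## Stubs (sizes) and what is load-bearing

1. `stub_oneBodyMaxwellian` — XL, open (at `d = 3` it is Spohn's local-equilibrium property (3.22) at the one-body level for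
   deterministic hard spheres at fixed reduced density; no instance in print). THE HARDEST STUB.
2. `stub_pairFactorisation` — XL, open (propagation of chaos at fixed reduced density over `≍ N^{1/d}` collision times;
   Lanford/GST2013/BGSS2023 give finite kinetic windows in the Boltzmann–Grad scaling only).
3. `stub_flowRelabelSymmetry` — M, provable now (relabelled hard-sphere trajectories are hard-sphere trajectories;
   `IsHardSphereTrajectory.unique_holds` / `HardSphereFlow.flow_eq_ae_holds`; grounder g15-19).
4. `stub_marginalsToFields` — L, provable now (Sznitman 1991 Prop. 2.2 with `(1+|v|²)` weights; twin of the Literature's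
   `tendstoEmpirical_of_flow_comp_perm_ae` for bounded test functions).
All four stubs occur in the proof term of `AllDimensionEuler_of` (drop any one and the composition does not typecheck).

Disproof used: none (no `Cruxes/AllDimensionEuler/Disproof.lean` exists at registration). Dead lines: none registered
for this crux. Barriers: `NoDensityExpansionBarrier` / `DiluteRegimeBarrier` bear on HOW stubs 1–2 might be proved (the
route's dressed-cumulant engine), not on this decomposition, which is technique-neutral.

[cite: Sznitman1991, Prop. 2.2] [cite: GST2013, §2.4, §6.1] [cite: Spohn1991, Part I §3.2 (3.21)–(3.22)]
-/

noncomputable section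

namespace Summit.AtomisticToContinuum.HydrodynamicLimit.Cruxes.AllDimensionEuler.EngineHalves

open scoped BigOperators Topology Classical MeasureTheory InnerProductSpace ENNReal
open Filter Set Function TopologicalSpace MeasureTheory
open Summit.AtomisticToContinuum.HydrodynamicLimit.Theses.DimensionLadder
  (AllDimensionEuler HighDimensionEuler LocalEquilibriumAllDim FreshPartnerStatisticsR FlowRelabelSymmetry
    MarginalsToFieldsAllDim EngineToAllDim Assembly closes)
-- NB. Only the listed route decls are opened: since route rev 22/23 (2026-08-17T03:06Z) the route file ALSO declares
-- `DimensionLadder.OneBodyMaxwellianAllDim` (stmt-18864), `DimensionLadder.PairFactorisationAllDim` (stmt-18871) and the glue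
-- `DimensionLadder.AllDimensionEulerOfHalves` (stmt-18943), byte-identical with this file's `OneBodyMaxwellianAllDim` /
-- `PairFactorisationAllDim` / the type of `AllDimensionEuler_of`'s parametric form; keeping them out of scope makes this
-- skeleton elaborate both before and after the farm rebuilds the route module (no ambiguous short names).

/-- PIECE 1 (crux) — ONE-BODY LAW = LOCAL MAXWELLIAN OF THE GUARDED EULER SOLUTION, every `d ≥ 3`. -/
def OneBodyMaxwellianAllDim : Prop :=
  ∀ d : ℕ, 3 ≤ d → ∃ η₀ : ℝ, 0 < η₀ ∧ ∀ (a₀ θ₀ : UnitAddTorus (Fin d) → ℝ) (u₀ : UnitAddTorus (Fin d) → EuclideanSpace ℝ (Fin d)), Continuous a₀ → Continuous θ₀ → Continuous u₀ → (∀ x, 0 < a₀ x) → (∀ x, 0 < θ₀ x) → ∃ σ₀ : ℝ, 0 < σ₀ ∧ ∀ σ : ℝ, 0 < σ → σ < σ₀ → ∀ (T : ℝ) (ρ θ : ℝ → UnitAddTorus (Fin d) → ℝ) (u : ℝ → UnitAddTorus (Fin d) → EuclideanSpace ℝ (Fin d)), Literature.MathematicalPhysics.KineticTheory.IsHardSphereEulerSolutionDim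 d σ T ρ u θ → (∀ t ∈ Set.Ico 0 T, ∀ x, ρ t x * σ ^ d < η₀) → ∀ Φ : (N : ℕ) → Literature.Analysis.FluidPDE.HardSphereFlow (Literature.Analysis.FluidPDE.Torus.geometry (Fin d)) (Literature.MathematicalPhysics.KineticTheory.hsDiameterDim d σ N) (N + 1), Literature.MathematicalPhysics.KineticTheory.TendstoHydroFieldsAtDim d (fun N => Literature.MathematicalPhysics.KineticTheory.localGibbsLawDim d σ a₀ u₀ θ₀ N (Φ N)) Φ ρ u θ 0 → ∀ t ∈ Set.Ico 0 T, Filter.Tendsto (fun N : ℕ => ∫⁻ y : UnitAddTorus (Fin d) × EuclideanSpace ℝ (Fin d), ENNReal.ofReal ((1 + ‖y.2‖ ^ 2) ^ 2 * |Literature.Analysis.FluidPDE.nthMarginal (N + 1) 1 ((Literature.Analysis.FluidPDE.hardSphereDomain (Literature.Analysis.FluidPDE.Torus.geometry (Fin d)) (N + 1) (Literature.MathematicalPhysics.KineticTheory.hsDiameterDim d σ N)).indicator (Literature.Analysis.FluidPDE.hsTransport (Φ N) t (Literature.Analysis.FluidPDE.canonicalDensity (Literature.Analysis.FluidPDE.Torus.geometry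 (Fin d)) (Literature.MathematicalPhysics.KineticTheory.hsDiameterDim d σ N) (N + 1) (Literature.MathematicalPhysics.KineticTheory.localGibbsProfileDim d a₀ u₀ θ₀)))) (fun _ => y) - Literature.MathematicalPhysics.KineticTheory.localGibbsProfileDim d (ρ t) (u t) (θ t) y|)) Filter.atTop (nhds 0)

/-- PIECE 2 (crux) — ASYMPTOTIC PAIR FACTORISATION of the time-`t` law, every `d ≥ 3`. -/
def PairFactorisationAllDim : Prop :=
  ∀ d : ℕ, 3 ≤ d → ∃ η₀ : ℝ, 0 < η₀ ∧ ∀ (a₀ θ₀ : UnitAddTorus (Fin d) → ℝ) (u₀ : UnitAddTorus (Fin d) → EuclideanSpace ℝ (Fin d)), Continuous a₀ → Continuous θ₀ → Continuous u₀ → (∀ x, 0 < a₀ x) → (∀ x, 0 < θ₀ x) → ∃ σ₀ : ℝ, 0 < σ₀ ∧ ∀ σ : ℝ, 0 < σ → σ < σ₀ → ∀ (T : ℝ) (ρ θ : ℝ → UnitAddTorus (Fin d) → ℝ) (u : ℝ → UnitAddTorus (Fin d) → EuclideanSpace ℝ (Fin d)), Literature.MathematicalPhysics.KineticTheory.IsHardSphereEulerSolutionDim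 d σ T ρ u θ → (∀ t ∈ Set.Ico 0 T, ∀ x, ρ t x * σ ^ d < η₀) → ∀ Φ : (N : ℕ) → Literature.Analysis.FluidPDE.HardSphereFlow (Literature.Analysis.FluidPDE.Torus.geometry (Fin d)) (Literature.MathematicalPhysics.KineticTheory.hsDiameterDim d σ N) (N + 1), Literature.MathematicalPhysics.KineticTheory.TendstoHydroFieldsAtDim d (fun N => Literature.MathematicalPhysics.KineticTheory.localGibbsLawDim d σ a₀ u₀ θ₀ N (Φ N)) Φ ρ u θ 0 → ∀ t ∈ Set.Ico 0 T, Filter.Tendsto (fun N : ℕ => ∫⁻ p : (UnitAddTorus (Fin d) × EuclideanSpace ℝ (Fin d)) × (UnitAddTorus (Fin d) × EuclideanSpace ℝ (Fin d)), ENNReal.ofReal ((1 + ‖p.1.2‖ ^ 2) * (1 + ‖p.2.2‖ ^ 2) * |Literature.Analysis.FluidPDE.nthMarginal (N + 1) 2 ((Literature.Analysis.FluidPDE.hardSphereDomain (Literature.Analysis.FluidPDE.Torus.geometry (Fin d)) (N + 1) (Literature.MathematicalPhysics.KineticTheory.hsDiameterDim d σ N)).indicator (Literature.Analysis.FluidPDE.hsTransport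 (Φ N) t (Literature.Analysis.FluidPDE.canonicalDensity (Literature.Analysis.FluidPDE.Torus.geometry (Fin d)) (Literature.MathematicalPhysics.KineticTheory.hsDiameterDim d σ N) (N + 1) (Literature.MathematicalPhysics.KineticTheory.localGibbsProfileDim d a₀ u₀ θ₀)))) ![p.1, p.2] - Literature.Analysis.FluidPDE.nthMarginal (N + 1) 1 ((Literature.Analysis.FluidPDE.hardSphereDomain (Literature.Analysis.FluidPDE.Torus.geometry (Fin d)) (N + 1) (Literature.MathematicalPhysics.KineticTheory.hsDiameterDim d σ N)).indicator (Literature.Analysis.FluidPDE.hsTransport (Φ N) t (Literature.Analysis.FluidPDE.canonicalDensity (Literature.Analysis.FluidPDE.Torus.geometry (Fin d)) (Literature.MathematicalPhysics.KineticTheory.hsDiameterDim d σ N) (N + 1) (Literature.MathematicalPhysics.KineticTheory.localGibbsProfileDim d a₀ u₀ θ₀)))) ![p.1] * Literature.Analysis.FluidPDE.nthMarginal (N + 1) 1 ((Literature.Analysis.FluidPDE.hardSphereDomain (Literature.Analysis.FluidPDE.Torus.geometry (Fin d)) (N + 1) (Literature.MathematicalPhysics.KineticTheory.hsDiameterDim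 d σ N)).indicator (Literature.Analysis.FluidPDE.hsTransport (Φ N) t (Literature.Analysis.FluidPDE.canonicalDensity (Literature.Analysis.FluidPDE.Torus.geometry (Fin d)) (Literature.MathematicalPhysics.KineticTheory.hsDiameterDim d σ N) (N + 1) (Literature.MathematicalPhysics.KineticTheory.localGibbsProfileDim d a₀ u₀ θ₀)))) ![p.2]|)) Filter.atTop (nhds 0)

open Literature.MathematicalPhysics.KineticTheory Literature.Analysis.FluidPDE Literature.Analysis.FunctionSpaces

/-- `AllDimensionEuler` is, rung by rung, the Literature's packing-guarded conjecture `HydroLimitInBandDim d`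
(`hydroLimitInBandDim_iff`). -/
theorem allDimensionEuler_iff_forall_hydroLimitInBandDim :
    AllDimensionEuler ↔ ∀ d : ℕ, 3 ≤ d → HydroLimitInBandDim d :=
  forall₂_congr fun d _ => (hydroLimitInBandDim_iff d).symm

/-- THE ASSEMBLY over the Literature form: the two engine halves, the relabelling symmetry and the marginals ⇒ fields
step give `HydroLimitInBandDim d` for every `d ≥ 3` — thresholds `η₀ := min η₁ η₂`, `σ₀ := min σ₁ σ₂`; continuity of
the time slices of the classical solution from joint smoothness; exchangeability from `FlowRelabelSymmetry`. -/
theorem forall_hydroLimitInBandDim_of_halves (h1 : OneBodyMaxwellianAllDim) (h2 : PairFactorisationAllDim)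
    (hS : FlowRelabelSymmetry) (hM : MarginalsToFieldsAllDim) :
    ∀ d : ℕ, 3 ≤ d → HydroLimitInBandDim d := by
  intro d hd
  obtain ⟨η₁, hη₁, H1⟩ := h1 d hd
  obtain ⟨η₂, hη₂, H2⟩ := h2 d hd
  refine ⟨min η₁ η₂, lt_min hη₁ hη₂, ?_⟩
  intro a₀ θ₀ u₀ ha hθ hu ha0 hθ0
  obtain ⟨σ₁, hσ₁, K1⟩ := H1 a₀ θ₀ u₀ ha hθ hu ha0 hθ0
  obtain ⟨σ₂, hσ₂, K2⟩ := H2 a₀ θ₀ u₀ ha hθ hu ha0 hθ0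
  refine ⟨min σ₁ σ₂, lt_min hσ₁ hσ₂, ?_⟩
  intro σ hσ hσlt T ρ θ u hsol hguard Φ h0 t ht
  have hσ₁' : σ < σ₁ := lt_of_lt_of_le hσlt (min_le_left _ _)
  have hσ₂' : σ < σ₂ := lt_of_lt_of_le hσlt (min_le_right _ _)
  have hguard₁ : ∀ s ∈ Set.Ico 0 T, ∀ x, ρ s x * σ ^ d < η₁ :=
    fun s hs x => lt_of_lt_of_le (hguard s hs x) (min_le_left _ _)
  have hguard₂ : ∀ s ∈ Set.Ico 0 T, ∀ x, ρ s x * σ ^ d < η₂ :=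
    fun s hs x => lt_of_lt_of_le (hguard s hs x) (min_le_right _ _)
  have hm1 := K1 σ hσ hσ₁' T ρ θ u hsol hguard₁ Φ h0 t ht
  have hm2 := K2 σ hσ hσ₂' T ρ θ u hsol hguard₂ Φ h0 t ht
  have hρc : Continuous (ρ t) := (hsol.smooth_density.isSmooth_slice ht).continuous
  have huc : Continuous (u t) := (hsol.smooth_velocity.isSmooth_slice ht).continuous
  have hθc : Continuous (θ t) := (hsol.smooth_temperature.isSmooth_slice ht).continuous
  have hθpos : ∀ x, 0 < θ t x := hsol.temperature_pos t ht
  have hsymm := fun (N : ℕ) (π : Equiv.Perm (Fin (N + 1))) => hS d hd σ a₀ θ₀ u₀ Φ t N π hσ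
  intro χ hχ δ hδ
  exact hM d hd σ a₀ θ₀ u₀ ρ θ u Φ t hσ ha hθ hu ha0 hθ0 hρc huc hθc hθpos hsymm hm1 hm2 χ hχ δ hδ


/-! ## The registered stubs -/

/-- STUB 1 (XL, open; NEW crux of the route-level split) — identification of the one-body law. -/
theorem stub_oneBodyMaxwellian : OneBodyMaxwellianAllDim := by
  sorry

/-- STUB 2 (XL, open; NEW crux of the route-level split) — asymptotic pair factorisation. -/
theorem stub_pairFactorisation : PairFactorisationAllDim := by
  sorry

/-- STUB 3 (M, provable now; = route support item stmt-AtomisticToContinuum-9346, by name). -/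
theorem stub_flowRelabelSymmetry : FlowRelabelSymmetry := by
  sorry

/-- STUB 4 (L, provable now; = route support item stmt-AtomisticToContinuum-9345, by name). -/
theorem stub_marginalsToFields : MarginalsToFieldsAllDim := by
  sorry

/-- **THE COMPOSITION** — the crux `AllDimensionEuler` BY NAME from the four registered stubs: the assembly
`forall_hydroLimitInBandDim_of_halves` (parametric, over the Literature form `∀ d ≥ 3, HydroLimitInBandDim d`) applied
to the stubs, transported to the inlined route decl by `allDimensionEuler_iff_forall_hydroLimitInBandDim`. This is the
only theorem of the file whose conclusion is the crux decl (the parametric four-hypothesis form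
`OneBodyMaxwellianAllDim → PairFactorisationAllDim → FlowRelabelSymmetry → MarginalsToFieldsAllDim → AllDimensionEuler`
is `fun h1 h2 hS hM => allDimensionEuler_iff_forall_hydroLimitInBandDim.2 (forall_hydroLimitInBandDim_of_halves h1 h2 hS hM)`,
kept in the strategist's Theorems candidate `DimensionLadderAllDimensionEulerSplit.lean`, evidence on stmt-9342). -/
theorem AllDimensionEuler_of : AllDimensionEuler :=
  allDimensionEuler_iff_forall_hydroLimitInBandDim.2
    (forall_hydroLimitInBandDim_of_halves stub_oneBodyMaxwellian stub_pairFactorisation stub_flowRelabelSymmetry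
      stub_marginalsToFields)

/-- The route's joint engine implies each half (projections, threaded through the quantifiers). -/
theorem oneBodyMaxwellianAllDim_of_engine (hL : LocalEquilibriumAllDim) : OneBodyMaxwellianAllDim := by
  intro d hd
  obtain ⟨η₀, hη₀, H⟩ := hL d hd
  refine ⟨η₀, hη₀, fun a₀ θ₀ u₀ ha hθ hu ha0 hθ0 => ?_⟩
  obtain ⟨σ₀, hσ₀, K⟩ := H a₀ θ₀ u₀ ha hθ hu ha0 hθ0
  refine ⟨σ₀, hσ₀, fun σ hσ hσ' T ρ θ u hsol hguard Φ h0 t ht => ?_⟩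
  exact (K σ hσ hσ' T ρ θ u hsol.smooth_density hsol.smooth_velocity hsol.smooth_temperature hsol.density_pos
    hsol.temperature_pos hsol.mass hsol.momentum hsol.energy hguard Φ h0 t ht).1

/-- The route's joint engine implies the pair half. -/
theorem pairFactorisationAllDim_of_engine (hL : LocalEquilibriumAllDim) : PairFactorisationAllDim := by
  intro d hd
  obtain ⟨η₀, hη₀, H⟩ := hL d hd
  refine ⟨η₀, hη₀, fun a₀ θ₀ u₀ ha hθ hu ha0 hθ0 => ?_⟩
  obtain ⟨σ₀, hσ₀, K⟩ := H a₀ θ₀ u₀ ha hθ hu ha0 hθ0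
  refine ⟨σ₀, hσ₀, fun σ hσ hσ' T ρ θ u hsol hguard Φ h0 t ht => ?_⟩
  exact (K σ hσ hσ' T ρ θ u hsol.smooth_density hsol.smooth_velocity hsol.smooth_temperature hsol.density_pos
    hsol.temperature_pos hsol.mass hsol.momentum hsol.energy hguard Φ h0 t ht).2

/-- The route's glue item `EngineToAllDim` (stmt-AtomisticToContinuum-14524), proved: engine ⇒ halves ⇒ target. -/
theorem engineToAllDim_holds : EngineToAllDim :=
  fun hL hS hM => allDimensionEuler_iff_forall_hydroLimitInBandDim.2
    (forall_hydroLimitInBandDim_of_halves (oneBodyMaxwellianAllDim_of_engine hL) (pairFactorisationAllDim_of_engine hL) hS hM)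

/-- The route's `Assembly` item (stmt-AtomisticToContinuum-17301), proved: `EngineToAllDim` composed with `closes`. -/
theorem assembly_holds : Assembly :=
  fun hL hS hM => closes (engineToAllDim_holds hL hS hM)

end Summit.AtomisticToContinuum.HydrodynamicLimit.Cruxes.AllDimensionEuler.EngineHalves

end
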